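import Mathlib.Tactic

/-!
# The resistive wall mode: thin-wall dispersion relation and the flat-current cylindrical model, as printed

Topic `Literature/MathematicalPhysics/MHD` (namespace `Literature.MathematicalPhysics.MHD`, sub-namespace
`ResistiveWall`). Typed as printed, with the elementary sign consequences PROVED:

* `ResistiveWall.IsThinWallRate δW_∞ δW_b τ_w γ` — `ω_i τ_w = −δW_∞/δW_b`
  [cite: Freidberg2014, §11.5.6 eq. (11.169)–(11.170) pp. 491–492] (division-free form), with
  `growth_pos` (regime `δW_∞ < 0 < δW_b` ⇒ `γ > 0`) and `decay_iff` («both `δW_∞` and `δW_b` must be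
  positive for stability», ibid. p. 492);
* the flat-current step model of [cite: Miyamoto2007, §9.4.1 eqs. (9.62)–(9.71) pp. 237–241] (after Finn 1995):
  `finnGammaSq s x = −2 s (1 + s/(1 − x))` (`s = nq − m`, `x = (a/d)^{2m}`; eq. (9.65)) and
  `finnRWMGrowth m x γ∞² γd² = (2m/(1 − x))·(−γ∞²/γd²)` (eq. (9.70)); the no-wall kink window, the
  wall-stabilisation window `γ_c(d)² < 0 ⇔ 1 + s < x`, positivity of the RWM rate in the printed regime,
  and the exact instance on the printed parameters `q = 1.05`, `(m,n) = (2,1)` of Fig. 9.11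
  (`d_cr/a = 20^{1/4} ∈ (2.114, 2.115)` vs printed `d_cr = 2.115`; `γ_res τ_w = 6156/4541` at `a/d = 2/3`).

MODEL (stated once): cylindrical screw pinch / straight tokamak, thin wall `w ≪ b`, marginal (`ω² ≈ 0`)
plasma response, NO rotation, NO kinetic effects; the flat-current model has step profiles `j = j₀`,
`ρ = ρ₀`, `q = const` inside `r < a`. The toroidal matrix form of the dispersion relation
[cite: Zheng2015, §2.2 eq. (2.38)] is not typed. Written for LADDER-GRIDFUSION rung F3 (model row 6).
-/

noncomputable section

namespace Literature.MathematicalPhysics.MHD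

namespace ResistiveWall

/-- **Thin-wall RWM dispersion relation, as printed** for a general cylindrical screw pinch:
`ω_i τ_w = −δW_∞/δW_b` [cite: Freidberg2014, §11.5.6 eq. (11.169) p. 491], `τ_w = μ₀ w b g/η` with the
geometric factor `g ≈ (1/2m)[1 − (a/b)^{2m}]` for `kb ≪ 1` [cite: Freidberg2014, eq. (11.170)], where
`δW_∞`, `δW_b` are the ideal energies of the external mode with the wall at infinity / a perfectly
conducting wall at `r = b` [cite: Freidberg2014, eq. (11.148)–(11.151)]. Typed division-free:
`γ τ_w δW_b = −δW_∞`. Toroidal geometry replaces this by the matrix eigenproblem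
`−V F₂⁻¹ δW_∞ δW_b⁻¹ F₁ d = τ_w γ_N d` [cite: Zheng2015, §2.2 eq. (2.38)] (not typed here).
Model: thin wall `w ≪ b`, `ω² ≈ 0` in the plasma (marginal equation), no rotation, no kinetic
effects. -/
def IsThinWallRate (δWinf δWb τw γ : ℝ) : Prop := γ * τw * δWb = -δWinf

/-- In the printed «interesting regime» `δW_∞ < 0 < δW_b` the RWM grows, `γ > 0` (for `τ_w > 0`):
«then ω_i > 0; the presence of a resistive wall introduces a new slowly growing mode»
[cite: Freidberg2014, §11.5.6 eq. (11.151) and p. 492]. -/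
theorem IsThinWallRate.growth_pos {δWinf δWb τw γ : ℝ} (h : IsThinWallRate δWinf δWb τw γ)
    (hτ : 0 < τw) (hinf : δWinf < 0) (hb : 0 < δWb) : 0 < γ := by
  unfold IsThinWallRate at h
  by_contra hle
  rw [not_lt] at hle
  have h1 : γ * τw ≤ 0 := by nlinarith
  have h2 : γ * τw * δWb ≤ 0 := by nlinarith
  linarith

/-- «Both `δW_∞` and `δW_b` must be positive for stability»: with `δW_b > 0`, `τ_w > 0`, the RWM rate
is negative iff `δW_∞ > 0` [cite: Freidberg2014, §11.5.6 p. 492]. -/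
theorem IsThinWallRate.decay_iff {δWinf δWb τw γ : ℝ} (h : IsThinWallRate δWinf δWb τw γ)
    (hτ : 0 < τw) (hb : 0 < δWb) : γ < 0 ↔ 0 < δWinf := by
  unfold IsThinWallRate at h
  constructor
  · intro hγ
    have h1 : γ * τw < 0 := by nlinarith
    have h2 : γ * τw * δWb < 0 := by nlinarith
    linarith
  · intro hinf
    by_contra hge
    rw [not_lt] at hge
    have h1 : 0 ≤ γ * τw := by nlinarith
    have h2 : 0 ≤ γ * τw * δWb := by nlinarith
    linarith

/-! ## The flat-current cylindrical model (Miyamoto §9.4.1, after Finn 1995)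

Step model: `j = j₀`, `ρ = ρ₀`, `q = const` for `r < a`, vacuum outside, wall at `r = d`; write
`s := n q − m` and `x := (a/d)^{2m}` (`x = 0` ⇔ wall at infinity). Printed results:
ideal growth rate with a conducting wall `γ_c(d)² τ_{Aθ}² = −2 s (1 + s/(1 − x))`
[cite: Miyamoto2007, eq. (9.65) p. 238]; thin resistive wall, regime `γ_c(d)² < 0 < γ_c(∞)²`:
`γ_res τ_w = (2m/(1 − x)) · (−γ_c(∞)²/γ_c(d)²)` [cite: Miyamoto2007, eq. (9.70) p. 240]. -/

/-- `γ_c² τ_{Aθ}²` of the flat-current model as a function of `s = nq − m` and `x = (a/d)^{2m}`,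
as printed [cite: Miyamoto2007, §9.4.1 eq. (9.65) p. 238]. Model: step profiles, cylinder. -/
def finnGammaSq (s x : ℝ) : ℝ := -2 * s * (1 + s / (1 - x))

/-- `γ_res τ_w` of the flat-current model with a thin resistive wall, as printed
[cite: Miyamoto2007, §9.4.1 eq. (9.70) p. 240]: `(2m/(1 − x)) · (−γ_c(∞)²/γ_c(d)²)`, valid in the regime
`γ_c(d)² < 0 < γ_c(∞)²` and `γ_res² ≪ |γ_c²|`. Model as above; no rotation. -/
def finnRWMGrowth (m : ℕ) (x γinfSq γdSq : ℝ) : ℝ := 2 * (m : ℝ) / (1 - x) * (-(γinfSq / γdSq))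

/-- No wall (`x = 0`): `γ_c(∞)² τ² = −2 s (1 + s) > 0` for `−1 < s < 0`, i.e. `m − 1 < n q < m` — the
external-kink window of the flat-current model [cite: Miyamoto2007, §9.4.1 eq. (9.65) p. 238 and Fig. 9.9]. -/
theorem finnGammaSq_noWall_pos {s : ℝ} (hs₁ : -1 < s) (hs₂ : s < 0) : 0 < finnGammaSq s 0 := by
  unfold finnGammaSq
  nlinarith

/-- **Wall-stabilisation window of the flat-current model**: for `s = nq − m < 0` and
`x = (a/d)^{2m} < 1` (physically `−1 < s`, `0 ≤ x`), the ideal mode is stabilised by a conducting wall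
(`γ_c(d)² < 0`) iff `1 + s < x`, i.e. `d/a < (1 + nq − m)^{−1/(2m)} =: d_cr/a` («stable region in the
nq − m – d/a diagram», «γ_c(d_cr) = 0») [cite: Miyamoto2007, §9.4.1 eq. (9.65), Fig. 9.9, p. 240]. -/
theorem finnGammaSq_neg_iff {s x : ℝ} (hs : s < 0) (hx₁ : x < 1) :
    finnGammaSq s x < 0 ↔ 1 + s < x := by
  unfold finnGammaSq
  have hx : 0 < 1 - x := by linarith
  have hx' : 1 - x ≠ 0 := hx.ne'
  rw [show -2 * s * (1 + s / (1 - x)) = (-2 * s) * ((1 - x + s) / (1 - x)) by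
    field_simp]
  have h2s : 0 < -2 * s := by linarith [hs]
  constructor
  · intro h
    have h3 : (1 - x + s) / (1 - x) < 0 := by
      by_contra hge; rw [not_lt] at hge
      exact absurd h (not_lt.mpr (mul_nonneg h2s.le hge))
    have h4 : 1 - x + s < 0 := by
      by_contra hge; rw [not_lt] at hge
      exact absurd h3 (not_lt.mpr (div_nonneg hge hx.le))
    linarith
  · intro h
    have : (1 - x + s) / (1 - x) < 0 := div_neg_of_neg_of_pos (by linarith) hx
    exact mul_neg_of_pos_of_neg h2s this

/-- In the RWM regime of the flat-current model (`γ_c(∞)² > 0 > γ_c(d)²`, `x < 1`, `m ≥ 1`) the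
printed resistive-wall growth rate is positive («the growth rate is the order of inverse resistive wall time
constant») [cite: Miyamoto2007, §9.4.1 eq. (9.70) p. 240]. -/
theorem finnRWMGrowth_pos {m : ℕ} {x γi γd : ℝ} (hm : 1 ≤ m) (hx₁ : x < 1)
    (hi : 0 < γi) (hd : γd < 0) : 0 < finnRWMGrowth m x γi γd := by
  unfold finnRWMGrowth
  have hm' : (1 : ℝ) ≤ (m : ℝ) := by exact_mod_cast hm
  have hmpos : (0 : ℝ) < 2 * (m : ℝ) := by linarith
  have h1 : 0 < 2 * (m : ℝ) / (1 - x) := div_pos hmpos (by linarith)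
  have h2 : γi / γd < 0 := div_neg_of_pos_of_neg hi hd
  exact mul_pos h1 (by linarith)

/-! ## Exact instance on the printed parameters `q = 1.05`, `(m,n) = (2,1)`
[cite: Miyamoto2007, Fig. 9.11 p. 240: «d_cr = 2.115 (R/a = 5, q₀ = 1.05, m = 2, n = 1)»].
Exact arithmetic on the printed parameters; a textbook-model instance, not a statement about any device. -/

/-- With `s = nq − m = −19/20`: the critical wall position of the flat-current model is
`d_cr/a = (1 + s)^{−1/4} = 20^{1/4}`, enclosed in `(2.114, 2.115)` — consistent with the printed
`d_cr = 2.115` (flat-current cylinder model) [cite: Miyamoto2007, §9.4.1 Fig. 9.11 p. 240]. -/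
theorem finn_dcr_enclosure :
    (2114 / 1000 : ℝ) ^ 4 < 1 / (1 + (-19 / 20 : ℝ)) ∧ 1 / (1 + (-19 / 20 : ℝ)) < (2115 / 1000 : ℝ) ^ 4 := by
  constructor <;> norm_num

/-- Same parameters, wall at `d/a = 3/2` (`x = (2/3)^4 = 16/81 > 1/20`, inside the window): the model is
ideal-wall-stabilised (`γ_c(d)² τ² = −4541/13000 < 0`), no-wall unstable (`γ_c(∞)² τ² = 19/200 > 0`),
and the printed RWM growth rate evaluates EXACTLY to `γ_res τ_w = 6156/4541 ≈ 1.356`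
[cite: Miyamoto2007, §9.4.1 eqs. (9.65), (9.70), Fig. 9.11 p. 240]. -/
theorem finn_rwm_instance :
    finnGammaSq (-19 / 20) (16 / 81) = -4541 / 13000 ∧ finnGammaSq (-19 / 20) 0 = 19 / 200 ∧
      finnRWMGrowth 2 (16 / 81) (19 / 200) (-4541 / 13000) = 6156 / 4541 := by
  refine ⟨?_, ?_, ?_⟩ <;> norm_num [finnGammaSq, finnRWMGrowth]

end ResistiveWall

end Literature.MathematicalPhysics.MHD

end
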